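import Literature.Claims.NS.ZhouXinyi2024
import Literature.Analysis.FluidPDE.GavrilovSteadyEulerProofs
import Literature.Analysis.FluidPDE.NSLerayHopfSereginEnergyProofs
import Summits.NavierStokesRegularity.NavierStokesRegularity.Theorems.SoloRefuteKyritsis2021
import HarnessLib

/-!
# C120 `ZhouXinyi2024` — kernel certificate for the NS-claims sweep (D-0090), refuter-8

Typed record: `Literature.Claims.NS.ZhouXinyi2024` (typist-5 g2, p482243), Zhou Xinyi, OSF Preprints
rc42s v2: title/abstract p.1 «given any initial conditions, there exist solutions … globally defined and
smooth» against §2.3 p.6 / §4 p.14 (under the symmetry assumptions §2.1 p.4 the solutions found are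
constants).

Kernel facts (sorry-free, standard axioms):

* `not_ClayDelta` — the typed bridging hypothesis to Clay (A) («every smooth divergence-free rapidly
  decaying datum is a constant field») is false: Gavrilov's compactly supported smooth divergence-free
  steady Euler field `U ≠ 0` (tree `gavrilov_compact_steady_euler_holds`) decays rapidly
  (`HasRapidSpatialDecay.of_hasCompactSupport`) and is not constant (a compactly supported constant
  field vanishes).
* `not_Step_1`, `not_Step_1P6` — erratum column: the p.5–6 reduction «(a, b, c, d) = (0, 0, 0, 0)» is
  false for the ansatz fields themselves: `a = (1, −1, 0)`, `C = (0, −1, 0)` (resp. `a = (1, 0, −1)`,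
  `C = (0, 0, −1)` for the letters printed on p.6), `d = 0`, `Re = ρ = 1` satisfy the reduced system at
  every point with `a ≠ 0` (typist-5 g2's witnesses, checked here).

WHAT THIS IS NOT: not a claim about NS regularity or blow-up; not a claim about any author beyond the
typed locator.
-/

set_option linter.dupNamespace false

noncomputable section

open Set Function
open Literature.Analysis.FluidPDE
open Literature.Claims.NS.ZhouXinyi2024 (diag ansatzVelocity ansatzVelocity_apply ReducedSystem
  ReducedSystemP6)
open Summit.NavierStokesRegularity.NavierStokesRegularity.Theorems.Kyritsis2021
  (exists_eq_zero_of_hasCompactSupport)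

namespace Summit.NavierStokesRegularity.NavierStokesRegularity.Theorems.ZhouXinyi2024

/-! ## The Clay bridge -/

/-- **The typed bridge `ClayDelta` («every Clay (A) datum is a constant field») is false (C120).**
Witness: Gavrilov's compactly supported smooth divergence-free field `U ≠ 0` on `ℝ³`; it is of class
(4), and were it a constant `c`, compact support would give a point with `U = 0`, so `c = 0` and `U = 0`.
[refuted-misstated relative to (A): the paper's construction covers constant data only.] [folklore] -/
theorem not_ClayDelta : ¬ Literature.Claims.NS.ZhouXinyi2024.ClayDelta := by
  intro h
  obtain ⟨U, P, hU, -, hUc, hU0, hdiv, -⟩ := gavrilov_compact_steady_euler_holds.exists_ne_zero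
  obtain ⟨c, hc⟩ := h U hU hdiv (HasRapidSpatialDecay.of_hasCompactSupport hU hUc)
  obtain ⟨x, -, hx⟩ := exists_eq_zero_of_hasCompactSupport hUc.norm 0
  have hcx : c = 0 := by
    have : ‖U x‖ = 0 := hx
    rw [hc] at this
    exact norm_eq_zero.mp this
  apply hU0
  rw [hc, hcx]
  rfl

/-! ## Erratum column: the p.5–6 reduction -/

/-- **Step 1 (§2.3 p.6 «(a, b, c, d) = (0, 0, 0, 0)») is false for the ansatz fields (C120).**
`Re = ρ = 1`, `a = (1, −1, 0)`, `C = (0, −1, 0)`, `d = 0`: the printed reduced system holds at every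
point and `a ≠ 0`. [folklore] -/
theorem not_Step_1 : ¬ Literature.Claims.NS.ZhouXinyi2024.Step_1 := by
  intro h
  have key := h 1 1 one_pos one_pos ![1, -1, 0] ![0, -1, 0] 0 (fun t x => by
    refine ⟨?_, ?_, ?_, ?_⟩ <;> simp [diag] <;> ring)
  have := congrFun key.1 0
  simp at this

/-- **Step 1 on the letters printed on p.6 is false as well (C120).** `Re = ρ = 1`, `a = (1, 0, −1)`,
`C = (0, 0, −1)`, `d = 0`. [folklore] -/
theorem not_Step_1P6 : ¬ Literature.Claims.NS.ZhouXinyi2024.Step_1P6 := by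
  intro h
  have key := h 1 1 one_pos one_pos ![1, 0, -1] ![0, 0, -1] 0 (fun t x => by
    refine ⟨?_, ?_, ?_, ?_⟩ <;> simp [diag] <;> ring)
  have := congrFun key.1 0
  simp at this

end Summit.NavierStokesRegularity.NavierStokesRegularity.Theorems.ZhouXinyi2024

end
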